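import Summits.QuantumFields.YangMills.Theorems.BalabanUVNodesN11NoExpansionGeneralStepLawsCoPHOldBranch
import Summits.QuantumFields.YangMills.Theorems.BalabanUVNodesN11NoExpansionGeneralStepRePinned

/-!
# DAG node N11 — THE NO-EXPANSION STEP AFTER AN ARBITRARY HISTORY AT THE RE-PINNED v1.7 PARAMETER `rePinH θ`, LAW LEVEL: at a new sequence `s′` with `Ω_{k+1}(s′) = ∅` the
# §2 form of `ρ_k` in the re-pinned weights (`SLaw₁₃CoPH (rePinH θ) p k`) gives the WHOLE PER-SEQUENCE CONJUNCT — law package AND clause — of the 𝐓-image form at `s′` and,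
# through 𝐑 on the live-selector line, of the §2 form of `ρ_{k+1}` at `s′`, with the residual-slot binders (P) `hpre`, (V) `hZ`, `hq`, `hqloc` GONE

Cell `pub-ymgap`, YM-PLAN Track A (HUMAN RULING D-0062), seat `pub-ymgap-dag-n11-e` (g13; R134 fan-out row N11∕s3), route `BalabanUVNodes` rev 25 (v1.7 `CoPH` key), item K1⁷
`StabilityBAtRecordR13SepCoPH` = stmt-QuantumFields-20542 (helper lane, count-neutral).  [III] = [Balaban1988Convergent], [IV] = [Balaban1989LargeFieldI].  The re-pinned companion
of this seat's `…NoExpansionGeneralStepLawsCoPH` (p550088) and `…NoExpansionGeneralStepLawsCoPHOldBranch` (p551777); the law-level companion of `…NoExpansionGeneralStepRePinnedPostRCoPH`.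

WHY THIS FILE.  The generic law-level faces (p550088 ∕ p551777) — «`LawsRT … k` ∧ clause at `init s′` ⇒ `∃ t₀`, `LawsT … k` ∧ 𝐓-clause at `s′` (carried witness TRUNCATED above `k`:
print's «no new terms» at a no-expansion step, (3.25) p. 270) ⇒ through 𝐑, `LawsRT … (k+1)` ∧ post-𝐑 clause at `s′`» — carry dag-n11-d's four residual-slot binders on the history's
𝐓-weight residual.  At dag-n11-d's re-pinned parameter `rePinH θ` (p552185; certificate family `ZhPinOfRecord₁₃`, level-free, `quad ≡ 0`) all four are THEOREMS at EVERY no-expansion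
history (`prefix_agree_rePinH`, `zhAt_rePinH_ζ0_univ_pairCfgAt`, `rfl`), and def-T's core provisos transfer (`provisos₁₃CoPH_rePinH`).  `rePinH θ` has the Stage-13 part of `θ`, so the
§2 tower of the witness, def-R's background, the run's constants, admissibility and the selector clause are literally those of `θ`.  HENCE (one application of the generic face at
`θ := rePinH θ` each, the four binders supplied by dag-n11-d's faces):
§1 (generic `θ`, 𝐓-side) `exists_lawsT_clause_succ_rePinH_of_Omega_empty_of_lawsRT_of_clause` (clause-keyed; displayed `hA`, `hm` ∕ `hC`, the signs `0 ≤ E₀, B₀`) · ★★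
   `exists_lawsT_clause_succ_rePinH_of_Omega_empty_of_sLaw₁₃CoPH_of_oldBranch` (keyed on `SLaw₁₃CoPH (rePinH θ) p k`; old-branch rows `hmB` ∕ `hCB`): the complete `s′`-conjunct of
   `TLaw₁₃CoPH (rePinH θ) p k`'s predicate.
§2 (generic `θ`, through 𝐑 on the live-selector line; admissibility and `0 ≤ κ` in addition) ★★ `exists_lawsRT_slotClause_succ_rePinH_of_Omega_empty_of_sLaw₁₃CoPH_of_liveSel` (`hm` ∕ `hC`) ·
   ★★ `…_of_sLaw₁₃CoPH_of_oldBranch_of_liveSel` (`hmB` ∕ `hCB`): the complete `s′`-conjunct of `SLaw₁₃CoPH (rePinH θ) p (k+1)`'s predicate — THEOREM 1's INDUCTIVE STEP ON EVERY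
   NO-EXPANSION BRANCH AFTER ANY HISTORY, LAWS INCLUDED, at the re-pinned parameter, from the §2 form of `ρ_k` there and the analytic rows ONLY.
§3 ★★ `exists_lawsRT_slotClause_succ_rePinH_door_ofCured_of_Omega_empty_of_liveSel` — at the re-pinned door of node00-def-K0a's cured family from `θ₀.Provisos₁₃Core`, the selector
   clause and admissibility of `θ₀`, the signs, `SLaw`, `hA`, `hmB` ∕ `hCB`, at EVERY no-expansion history · ★★ `exists_lawsRT_slotClause_succ_rePinH_door_theta13LiveOfRecord_of_Omega_empty`
   (at the witness of record: selector clause ∕ row `rstep` are theorems, `M = 1`, `κ = 2·10⁴`, `E₀ = B₀ = 1` by the family's numerals; admissibility displayed).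

HONEST FRAMING.  Count-neutral kernel bookkeeping at ONE new sequence per old history on the no-expansion branch; the law package is that of the truncated carried witness,
obtained from `SLaw_k`'s by bookkeeping — NO estimate of [III] §3 used or asserted; NOT `TLaw₁₃CoPH (rePinH θ) p k`, NOT `SLaw₁₃CoPH (rePinH θ) p (k+1)` (the sequences with
`Ω_{k+1}(s′) ≠ ∅` are [III] Sect. 1 ∕ §3 ∕ Thm 2 proper); `hA`, `hm` ∕ `hC` (`hmB` ∕ `hCB`) stay displayed as in p544575 ∕ p547524; the zero branch is not excluded; the certificate family is
NOT H3's value of record; nothing of Bałaban asserted; N11 NOT discharged; K1⁷ NOT closed; counts unmoved (typed 28∕28 · discharged 5∕27).  Finite `𝕋⁴_{L^K}`, fixed `ε = L^{−K}`;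
NOT ℝ⁴ ∕ OS ∕ mass-gap ∕ Clay.
Sources: [III] Thm 1 p.262, §2 p.262, Theorem p.245, (2.23)–(2.31) pp.258–260, (2.40)–(2.42) p.261, (3.16)–(3.20) pp.268–269, (3.24)–(3.25) p.270, p.279; [IV] (0.2)–(0.4) p.176,
p.177 (i)–(ii); [Balaban1987RG1] (0.20) p.256.
-/

noncomputable section

open MeasureTheory
open scoped BigOperators Matrix.Norms.L2Operator

namespace Summit.QuantumFields.YangMills.Theorems.BalabanUVNodesN11NoExpansionGeneralStepRePinnedLawsCoPH

open Literature.MathematicalPhysics.QuantumFieldTheory.Balaban1983to89 T4Continuum Node00 Node00.Tk DagBinding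
open Literature.MathematicalPhysics.QuantumFieldTheory.Balaban1983to89.B16RLeafRecord13LiveGenericZS
open BalabanUVNodesN11RePinnedParamDefs (rePinH provisos₁₃CoPH_rePinH prefix_agree_rePinH zhAt_rePinH_ζ0_univ_pairCfgAt)
open BalabanUVNodesN11NoExpansionGeneralStepLawsCoPH (exists_lawsT_clause_succ_CoPH_of_Omega_empty_of_lawsRT_of_clause
  exists_lawsRT_slotClause_succ_CoPH_of_Omega_empty_of_sLaw₁₃CoPH_of_liveSel)
open BalabanUVNodesN11NoExpansionGeneralStepLawsCoPHOldBranch (exists_lawsT_clause_succ_CoPH_of_Omega_empty_of_sLaw₁₃CoPH_of_oldBranch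
  exists_lawsRT_slotClause_succ_CoPH_of_Omega_empty_of_sLaw₁₃CoPH_of_oldBranch_of_liveSel)

variable {F : T4Family} {N : ℕ} [NeZero N]

/-! ## §1. The 𝐓-side at `rePinH θ`, law + clause -/

section RePinned

variable (θ : Stage13HParams F N) (p : B12.RunParams)

/-- **★ THE 𝐓-SIDE OF THE NO-EXPANSION STEP AFTER ANY HISTORY AT `rePinH θ`, LAW + CLAUSE, CLAUSE-KEYED** (p550088 `exists_lawsT_clause_succ_CoPH_of_Omega_empty_of_lawsRT_of_clause` at
`θ := rePinH θ`, the four residual-slot binders supplied by dag-n11-d's faces): from def-T's core provisos at `θ`, `k < K`, `1 ≤ M`, `0 ≤ E₀, B₀`, a new `s′` with `Ω_{k+1}(s′) = ∅`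
after ANY history, and a witness `(t, E₀)` carrying at `init s′` the inductive assumptions `LawsRT … k`, the level-`k` clause `hid` in the re-pinned weights, `hA`, `hm` ∕ `hC`:
THERE ARE term values `t₀` with `Sect2.LawsT (sect2TowerOfRecord … (θ.rzAt p s′) s′ t₀) lf βc k` AND the 𝐓-image clause at `s′` in the re-pinned weights (witness: `t` truncated
above `k`). [cite: Balaban1988Convergent, Thm 1 p.262, §2 p.262, Theorem p.245, (3.24)–(3.25) p.270, (2.23)–(2.31) pp.258–260, (2.40)–(2.42) p.261, (3.16)–(3.20) pp.268–269; Balaban1989LargeFieldI, (0.2)–(0.3) p.176; Balaban1987RG1, (0.20) p.256] -/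
theorem exists_lawsT_clause_succ_rePinH_of_Omega_empty_of_lawsRT_of_clause (h : θ.Provisos₁₃CoPH F N) {k : ℕ} (hk : k < p.K) (hM : 1 ≤ θ.τ9.M)
    (hE₀ : 0 ≤ θ.s2.lf.E₀) (hB₀ : 0 ≤ θ.s2.lf.B₀)
    (s : SeqOfRecord F θ.ν θ.τ9.M (gOfRecord₁₃ F N θ.toStage13Params p) p.K (k + 1)) (hΩ : s.Ω (k + 1) = ∅)
    (t : Sect2.TermValues (F.P p.K) (MatA N) (FluctV N) θ.τ9.M) (E₀ : ℝ)
    (hA : ∀ (S : ℕ → Set (Site (F.P p.K) 0)) (a a' : Tk.MSFluct (F.P p.K) (FluctV N)) (Uf : GaugeField (F.P p.K) 0 (SU N)), (∀ i, i ≤ k → a i = a' i) →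
      (sect2ActionDataOfRecord F N (FluctV N) p.K (settingOfRecord₁₃ F N θ.toStage13Params p) (θ.rzAt p s.init) s.init t (S, a) E₀).action23 k Uf =
        (sect2ActionDataOfRecord F N (FluctV N) p.K (settingOfRecord₁₃ F N θ.toStage13Params p) (θ.rzAt p s.init) s.init t (S, a') E₀).action23 k Uf)
    (hlaw : Sect2.LawsRT (sect2TowerOfRecord F N (FluctV N) p.K (settingOfRecord₁₃ F N θ.toStage13Params p) (θ.rzAt p s.init) s.init t)
      (settingOfRecord₁₃ F N θ.toStage13Params p).lf k)
    (hid : slotsOfRecord F N θ.ν θ.τ9 (EOfRecord₁₃ F N θ.toStage13Params) (wOfRecord₉ F N θ.toStage9Params) θ.ppSel p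
        (gOfRecord₁₃ F N θ.toStage13Params p) k s.init = 0 ∨
      ∀ᵐ U₀ ∂fieldMeasure (F.P p.K) k (SU N),
        chiSeqOfRecord F N θ.ν θ.τ9.M (gOfRecord₁₃ F N θ.toStage13Params p) p.K k s.init U₀ ≠ 0 →
          slotsOfRecord F N θ.ν θ.τ9 (EOfRecord₁₃ F N θ.toStage13Params) (wOfRecord₉ F N θ.toStage9Params) θ.ppSel p
              (gOfRecord₁₃ F N θ.toStage13Params p) k s.init U₀ =
            sect2Slot F N (FluctV N) p.K (settingOfRecord₁₃ F N θ.toStage13Params p) (θ.rzAt p s.init) (WtOfRecord₁₃H F N (rePinH θ) p s.init) s.init t E₀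
              (UbgOfRecord₁₃CoP F N θ.toStage13Params p k s.init) U₀)
    {C : ℝ}
    (hm : ∀ S ∈ admSOfRecord F θ.ν θ.τ9.M (gOfRecord₁₃ F N θ.toStage13Params p) p.K k s.init,
      Measurable (Function.uncurry (noExpIntegrandAt F N (FluctV N) p.K k (WtOfRecord₁₃H F N (rePinH θ) p s)
        (tkBranchOfRecord F N (FluctV N) θ.ν θ.τ9.M _ p.K (WtOfRecord₁₃H F N (rePinH θ) p s) s.init S k
          (fun ω => sect2Operand F N (FluctV N) p.K (settingOfRecord₁₃ F N θ.toStage13Params p) (θ.rzAt p s) s t E₀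
            (UbgOfRecord₁₃CoP F N θ.toStage13Params p (k + 1) s) (S, fun j => (ω j).2) (fun j => (ω j).1))))))
    (hC : ∀ S ∈ admSOfRecord F θ.ν θ.τ9.M (gOfRecord₁₃ F N θ.toStage13Params p) p.K k s.init, ∀ V' U₀,
      |noExpIntegrandAt F N (FluctV N) p.K k (WtOfRecord₁₃H F N (rePinH θ) p s)
        (tkBranchOfRecord F N (FluctV N) θ.ν θ.τ9.M _ p.K (WtOfRecord₁₃H F N (rePinH θ) p s) s.init S k
          (fun ω => sect2Operand F N (FluctV N) p.K (settingOfRecord₁₃ F N θ.toStage13Params p) (θ.rzAt p s) s t E₀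
            (UbgOfRecord₁₃CoP F N θ.toStage13Params p (k + 1) s) (S, fun j => (ω j).2) (fun j => (ω j).1)))
        V' U₀| ≤ C) :
    ∃ t₀ : Sect2.TermValues (F.P p.K) (MatA N) (FluctV N) θ.τ9.M,
      Sect2.LawsT (sect2TowerOfRecord F N (FluctV N) p.K (settingOfRecord₁₃ F N θ.toStage13Params p) (θ.rzAt p s) s t₀)
          (settingOfRecord₁₃ F N θ.toStage13Params p).lf (settingOfRecord₁₃ F N θ.toStage13Params p).βc k ∧
        (slotsTOfRecord F N θ.ν θ.τ9 (EOfRecord₁₃ F N θ.toStage13Params) (wOfRecord₉ F N θ.toStage9Params) θ.ppSel p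
            (gOfRecord₁₃ F N θ.toStage13Params p) (k + 1) s = 0 ∨
          ∀ᵐ V' ∂fieldMeasure (F.P p.K) (k + 1) (SU N),
            chiSeqOfRecord F N θ.ν θ.τ9.M (gOfRecord₁₃ F N θ.toStage13Params p) p.K (k + 1) s V' ≠ 0 →
              slotsTOfRecord F N θ.ν θ.τ9 (EOfRecord₁₃ F N θ.toStage13Params) (wOfRecord₉ F N θ.toStage9Params) θ.ppSel p
                  (gOfRecord₁₃ F N θ.toStage13Params p) (k + 1) s V' =
                sect2Slot F N (FluctV N) p.K (settingOfRecord₁₃ F N θ.toStage13Params p) (θ.rzAt p s) (WtOfRecord₁₃H F N (rePinH θ) p s) s t₀ E₀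
                  (UbgOfRecord₁₃CoP F N θ.toStage13Params p (k + 1) s) V') :=
  exists_lawsT_clause_succ_CoPH_of_Omega_empty_of_lawsRT_of_clause (rePinH θ) p (provisos₁₃CoPH_rePinH h) hk hM hE₀ hB₀ s hΩ
    (fun _ _ _ _ _ => rfl) (prefix_agree_rePinH θ p s hΩ) t E₀ hA hlaw hid (zhAt_rePinH_ζ0_univ_pairCfgAt θ p hk s hΩ) (fun _ _ => rfl) hm hC

/-- **★★ THE 𝐓-SIDE AT `rePinH θ`, LAW + CLAUSE, from `SLaw₁₃CoPH (rePinH θ) p k`, OLD-BRANCH FORM** (p551777 `exists_lawsT_clause_succ_CoPH_of_Omega_empty_of_sLaw₁₃CoPH_of_oldBranch` at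
`θ := rePinH θ`): from the §2 form of `ρ_k` in the re-pinned weights, def-T's core provisos at `θ`, `k < K`, `1 ≤ M`, `0 ≤ E₀, B₀`, a new `s′` with `Ω_{k+1}(s′) = ∅` after ANY history,
and ONLY the analytic rows `hA`, `hmB`, `hCB` (every `(t₀, E₀)`): THERE ARE `t₀`, `E′` with `Sect2.LawsT (sect2TowerOfRecord … (θ.rzAt p s′) s′ t₀) lf βc k` AND the 𝐓-image clause of
`slotT_{k+1}(s′)` at `(t₀, E′)` — the complete `s′`-conjunct of `TLaw₁₃CoPH (rePinH θ) p k`'s predicate `HasSect2FormTAEZS`. [cite: Balaban1988Convergent, Thm 1 p.262, §2 p.262, Theorem p.245, (3.24)–(3.25) p.270, (2.23)–(2.31) pp.258–260, (2.40)–(2.42) p.261, (3.16)–(3.20) pp.268–269; Balaban1989LargeFieldI, (0.2)–(0.3) p.176; Balaban1987RG1, (0.20) p.256] -/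
theorem exists_lawsT_clause_succ_rePinH_of_Omega_empty_of_sLaw₁₃CoPH_of_oldBranch (h : θ.Provisos₁₃CoPH F N) {k : ℕ} (hk : k < p.K) (hM : 1 ≤ θ.τ9.M)
    (hE₀ : 0 ≤ θ.s2.lf.E₀) (hB₀ : 0 ≤ θ.s2.lf.B₀) (hS : SLaw₁₃CoPH F N (rePinH θ) p k)
    (s : SeqOfRecord F θ.ν θ.τ9.M (gOfRecord₁₃ F N θ.toStage13Params p) p.K (k + 1)) (hΩ : s.Ω (k + 1) = ∅)
    (hA : ∀ (t₀ : Sect2.TermValues (F.P p.K) (MatA N) (FluctV N) θ.τ9.M) (E₀ : ℝ) (S : ℕ → Set (Site (F.P p.K) 0))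
      (a a' : Tk.MSFluct (F.P p.K) (FluctV N)) (Uf : GaugeField (F.P p.K) 0 (SU N)), (∀ i, i ≤ k → a i = a' i) →
      (sect2ActionDataOfRecord F N (FluctV N) p.K (settingOfRecord₁₃ F N θ.toStage13Params p) (θ.rzAt p s.init) s.init t₀ (S, a) E₀).action23 k Uf =
        (sect2ActionDataOfRecord F N (FluctV N) p.K (settingOfRecord₁₃ F N θ.toStage13Params p) (θ.rzAt p s.init) s.init t₀ (S, a') E₀).action23 k Uf)
    {C : ℝ}
    (hmB : ∀ (t₀ : Sect2.TermValues (F.P p.K) (MatA N) (FluctV N) θ.τ9.M) (E₀ : ℝ),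
      ∀ S ∈ admSOfRecord F θ.ν θ.τ9.M (gOfRecord₁₃ F N θ.toStage13Params p) p.K k s.init,
      Measurable fun U₀ : GaugeField (F.P p.K) k (SU N) =>
        tkBranchOfRecord F N (FluctV N) θ.ν θ.τ9.M _ p.K (WtOfRecord₁₃H F N (rePinH θ) p s) s.init S k
          (fun ω => sect2Operand F N (FluctV N) p.K (settingOfRecord₁₃ F N θ.toStage13Params p) (θ.rzAt p s.init) s.init t₀ E₀
            (UbgOfRecord₁₃CoP F N θ.toStage13Params p k s.init) (S, fun j => (ω j).2) (fun j => (ω j).1))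
          (baseCfg (V := FluctV N) k U₀))
    (hCB : ∀ (t₀ : Sect2.TermValues (F.P p.K) (MatA N) (FluctV N) θ.τ9.M) (E₀ : ℝ),
      ∀ S ∈ admSOfRecord F θ.ν θ.τ9.M (gOfRecord₁₃ F N θ.toStage13Params p) p.K k s.init, ∀ U₀ : GaugeField (F.P p.K) k (SU N),
      |tkBranchOfRecord F N (FluctV N) θ.ν θ.τ9.M _ p.K (WtOfRecord₁₃H F N (rePinH θ) p s) s.init S k
          (fun ω => sect2Operand F N (FluctV N) p.K (settingOfRecord₁₃ F N θ.toStage13Params p) (θ.rzAt p s.init) s.init t₀ E₀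
            (UbgOfRecord₁₃CoP F N θ.toStage13Params p k s.init) (S, fun j => (ω j).2) (fun j => (ω j).1))
          (baseCfg (V := FluctV N) k U₀)| ≤ C) :
    ∃ (t₀ : Sect2.TermValues (F.P p.K) (MatA N) (FluctV N) θ.τ9.M) (E' : ℝ),
      Sect2.LawsT (sect2TowerOfRecord F N (FluctV N) p.K (settingOfRecord₁₃ F N θ.toStage13Params p) (θ.rzAt p s) s t₀)
          (settingOfRecord₁₃ F N θ.toStage13Params p).lf (settingOfRecord₁₃ F N θ.toStage13Params p).βc k ∧
        (slotsTOfRecord F N θ.ν θ.τ9 (EOfRecord₁₃ F N θ.toStage13Params) (wOfRecord₉ F N θ.toStage9Params) θ.ppSel p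
            (gOfRecord₁₃ F N θ.toStage13Params p) (k + 1) s = 0 ∨
          ∀ᵐ V' ∂fieldMeasure (F.P p.K) (k + 1) (SU N),
            chiSeqOfRecord F N θ.ν θ.τ9.M (gOfRecord₁₃ F N θ.toStage13Params p) p.K (k + 1) s V' ≠ 0 →
              slotsTOfRecord F N θ.ν θ.τ9 (EOfRecord₁₃ F N θ.toStage13Params) (wOfRecord₉ F N θ.toStage9Params) θ.ppSel p
                  (gOfRecord₁₃ F N θ.toStage13Params p) (k + 1) s V' =
                sect2Slot F N (FluctV N) p.K (settingOfRecord₁₃ F N θ.toStage13Params p) (θ.rzAt p s) (WtOfRecord₁₃H F N (rePinH θ) p s) s t₀ E'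
                  (UbgOfRecord₁₃CoP F N θ.toStage13Params p (k + 1) s) V') :=
  exists_lawsT_clause_succ_CoPH_of_Omega_empty_of_sLaw₁₃CoPH_of_oldBranch (rePinH θ) p (provisos₁₃CoPH_rePinH h) hk hM hE₀ hB₀ hS s hΩ
    (fun _ _ _ _ _ => rfl) (prefix_agree_rePinH θ p s hΩ) hA (zhAt_rePinH_ζ0_univ_pairCfgAt θ p hk s hΩ) (fun _ _ => rfl) hmB hCB

/-! ## §2. Through 𝐑 on the live-selector line: the complete `s′`-conjunct of the §2 form of `ρ_{k+1}` at `rePinH θ` -/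

/-- **★★ THEOREM 1's INDUCTIVE STEP ON THE NO-EXPANSION BRANCH AFTER ANY HISTORY, LAWS INCLUDED, AT `rePinH θ`, READ THROUGH 𝐑** (p550088
`exists_lawsRT_slotClause_succ_CoPH_of_Omega_empty_of_sLaw₁₃CoPH_of_liveSel` at `θ := rePinH θ`): from the §2 form of `ρ_k` in the re-pinned weights, def-T's core provisos and
live-selector clause at `θ`, admissibility, `0 ≤ κ, E₀, B₀`, `k < K`, `1 ≤ M`, a new `s′` with `Ω_{k+1}(s′) = ∅` after ANY history and ONLY `hA`, `hm`, `hC` (every `(t₀, E₀)`): THERE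
ARE `t₀`, `E′` with `Sect2.LawsRT (sect2TowerOfRecord … (θ.rzAt p s′) s′ t₀) lf (k+1)` AND the post-𝐑 §2 dichotomy of `ρ_{k+1}`'s slot at `s′` in the re-pinned weights — the complete
`s′`-conjunct of `SLaw₁₃CoPH (rePinH θ) p (k+1)`'s predicate; NO residual-slot hypothesis. [cite: Balaban1988Convergent, Thm 1 p.262, §2 p.262, Theorem p.245, (3.24)–(3.25) p.270, (2.17)–(2.18) p.257, (3.16)–(3.20) pp.268–269, p.279; Balaban1989LargeFieldI, (0.2)–(0.4) p.176, p.177 (i)–(ii)] -/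
theorem exists_lawsRT_slotClause_succ_rePinH_of_Omega_empty_of_sLaw₁₃CoPH_of_liveSel (h : θ.Provisos₁₃CoPH F N)
    (hsel : θ.ppSel = ppSelLiveOfRecord F N θ.ν θ.τ9 (EOfRecord₁₃ F N θ.toStage13Params) (wOfRecord₉ F N θ.toStage9Params))
    (hθ : θ.Admissible F N) (hκ : 0 ≤ θ.s2.lf.κ) (hE₀ : 0 ≤ θ.s2.lf.E₀) (hB₀ : 0 ≤ θ.s2.lf.B₀)
    {k : ℕ} (hk : k < p.K) (hM : 1 ≤ θ.τ9.M) (hS : SLaw₁₃CoPH F N (rePinH θ) p k)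
    (s : SeqOfRecord F θ.ν θ.τ9.M (gOfRecord₁₃ F N θ.toStage13Params p) p.K (k + 1)) (hΩ : s.Ω (k + 1) = ∅)
    (hA : ∀ (t₀ : Sect2.TermValues (F.P p.K) (MatA N) (FluctV N) θ.τ9.M) (E₀ : ℝ) (S : ℕ → Set (Site (F.P p.K) 0))
      (a a' : Tk.MSFluct (F.P p.K) (FluctV N)) (Uf : GaugeField (F.P p.K) 0 (SU N)), (∀ i, i ≤ k → a i = a' i) →
      (sect2ActionDataOfRecord F N (FluctV N) p.K (settingOfRecord₁₃ F N θ.toStage13Params p) (θ.rzAt p s.init) s.init t₀ (S, a) E₀).action23 k Uf =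
        (sect2ActionDataOfRecord F N (FluctV N) p.K (settingOfRecord₁₃ F N θ.toStage13Params p) (θ.rzAt p s.init) s.init t₀ (S, a') E₀).action23 k Uf)
    {C : ℝ}
    (hm : ∀ (t₀ : Sect2.TermValues (F.P p.K) (MatA N) (FluctV N) θ.τ9.M) (E₀ : ℝ),
      ∀ S ∈ admSOfRecord F θ.ν θ.τ9.M (gOfRecord₁₃ F N θ.toStage13Params p) p.K k s.init,
      Measurable (Function.uncurry (noExpIntegrandAt F N (FluctV N) p.K k (WtOfRecord₁₃H F N (rePinH θ) p s)
        (tkBranchOfRecord F N (FluctV N) θ.ν θ.τ9.M _ p.K (WtOfRecord₁₃H F N (rePinH θ) p s) s.init S k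
          (fun ω => sect2Operand F N (FluctV N) p.K (settingOfRecord₁₃ F N θ.toStage13Params p) (θ.rzAt p s) s t₀ E₀
            (UbgOfRecord₁₃CoP F N θ.toStage13Params p (k + 1) s) (S, fun j => (ω j).2) (fun j => (ω j).1))))))
    (hC : ∀ (t₀ : Sect2.TermValues (F.P p.K) (MatA N) (FluctV N) θ.τ9.M) (E₀ : ℝ),
      ∀ S ∈ admSOfRecord F θ.ν θ.τ9.M (gOfRecord₁₃ F N θ.toStage13Params p) p.K k s.init, ∀ V' U₀,
      |noExpIntegrandAt F N (FluctV N) p.K k (WtOfRecord₁₃H F N (rePinH θ) p s)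
        (tkBranchOfRecord F N (FluctV N) θ.ν θ.τ9.M _ p.K (WtOfRecord₁₃H F N (rePinH θ) p s) s.init S k
          (fun ω => sect2Operand F N (FluctV N) p.K (settingOfRecord₁₃ F N θ.toStage13Params p) (θ.rzAt p s) s t₀ E₀
            (UbgOfRecord₁₃CoP F N θ.toStage13Params p (k + 1) s) (S, fun j => (ω j).2) (fun j => (ω j).1)))
        V' U₀| ≤ C) :
    ∃ (t₀ : Sect2.TermValues (F.P p.K) (MatA N) (FluctV N) θ.τ9.M) (E' : ℝ),
      Sect2.LawsRT (sect2TowerOfRecord F N (FluctV N) p.K (settingOfRecord₁₃ F N θ.toStage13Params p) (θ.rzAt p s) s t₀)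
          (settingOfRecord₁₃ F N θ.toStage13Params p).lf (k + 1) ∧
        (slotsOfRecord F N θ.ν θ.τ9 (EOfRecord₁₃ F N θ.toStage13Params) (wOfRecord₉ F N θ.toStage9Params) θ.ppSel p
            (gOfRecord₁₃ F N θ.toStage13Params p) (k + 1) s = 0 ∨
          ∀ᵐ V' ∂fieldMeasure (F.P p.K) (k + 1) (SU N),
            chiSeqOfRecord F N θ.ν θ.τ9.M (gOfRecord₁₃ F N θ.toStage13Params p) p.K (k + 1) s V' ≠ 0 →
              slotsOfRecord F N θ.ν θ.τ9 (EOfRecord₁₃ F N θ.toStage13Params) (wOfRecord₉ F N θ.toStage9Params) θ.ppSel p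
                  (gOfRecord₁₃ F N θ.toStage13Params p) (k + 1) s V' =
                sect2Slot F N (FluctV N) p.K (settingOfRecord₁₃ F N θ.toStage13Params p) (θ.rzAt p s) (WtOfRecord₁₃H F N (rePinH θ) p s) s t₀ E'
                  (UbgOfRecord₁₃CoP F N θ.toStage13Params p (k + 1) s) V') :=
  exists_lawsRT_slotClause_succ_CoPH_of_Omega_empty_of_sLaw₁₃CoPH_of_liveSel (rePinH θ) p (provisos₁₃CoPH_rePinH h) hsel hθ hκ hE₀ hB₀ hk hM hS s hΩ
    (fun _ _ _ _ _ => rfl) (prefix_agree_rePinH θ p s hΩ) hA (zhAt_rePinH_ζ0_univ_pairCfgAt θ p hk s hΩ) (fun _ _ => rfl) hm hC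

/-- **★★ … OLD-BRANCH FORM** (p551777 `exists_lawsRT_slotClause_succ_CoPH_of_Omega_empty_of_sLaw₁₃CoPH_of_oldBranch_of_liveSel` at `θ := rePinH θ`): the same from ONLY `hA`,
`hmB`, `hCB` — `LawsRT … (k+1)` ∧ the post-𝐑 §2 dichotomy of `ρ_{k+1}`'s slot at `s′` in the re-pinned weights, at every no-expansion `s′` after any history; NO residual-slot
hypothesis.  At `rePinH θ`, `hmB` further reduces to measurability of the operand alone (dag-n11-d's `…RePinnedOldBranchMeasurable`). [cite: Balaban1988Convergent, Thm 1 p.262, §2 p.262, Theorem p.245, (3.24)–(3.25) p.270, (2.17)–(2.18) p.257, (3.16) p.268, p.279; Balaban1989LargeFieldI, (0.2)–(0.4) p.176, p.177 (i)–(ii)] -/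
theorem exists_lawsRT_slotClause_succ_rePinH_of_Omega_empty_of_sLaw₁₃CoPH_of_oldBranch_of_liveSel (h : θ.Provisos₁₃CoPH F N)
    (hsel : θ.ppSel = ppSelLiveOfRecord F N θ.ν θ.τ9 (EOfRecord₁₃ F N θ.toStage13Params) (wOfRecord₉ F N θ.toStage9Params))
    (hθ : θ.Admissible F N) (hκ : 0 ≤ θ.s2.lf.κ) (hE₀ : 0 ≤ θ.s2.lf.E₀) (hB₀ : 0 ≤ θ.s2.lf.B₀)
    {k : ℕ} (hk : k < p.K) (hM : 1 ≤ θ.τ9.M) (hS : SLaw₁₃CoPH F N (rePinH θ) p k)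
    (s : SeqOfRecord F θ.ν θ.τ9.M (gOfRecord₁₃ F N θ.toStage13Params p) p.K (k + 1)) (hΩ : s.Ω (k + 1) = ∅)
    (hA : ∀ (t₀ : Sect2.TermValues (F.P p.K) (MatA N) (FluctV N) θ.τ9.M) (E₀ : ℝ) (S : ℕ → Set (Site (F.P p.K) 0))
      (a a' : Tk.MSFluct (F.P p.K) (FluctV N)) (Uf : GaugeField (F.P p.K) 0 (SU N)), (∀ i, i ≤ k → a i = a' i) →
      (sect2ActionDataOfRecord F N (FluctV N) p.K (settingOfRecord₁₃ F N θ.toStage13Params p) (θ.rzAt p s.init) s.init t₀ (S, a) E₀).action23 k Uf =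
        (sect2ActionDataOfRecord F N (FluctV N) p.K (settingOfRecord₁₃ F N θ.toStage13Params p) (θ.rzAt p s.init) s.init t₀ (S, a') E₀).action23 k Uf)
    {C : ℝ}
    (hmB : ∀ (t₀ : Sect2.TermValues (F.P p.K) (MatA N) (FluctV N) θ.τ9.M) (E₀ : ℝ),
      ∀ S ∈ admSOfRecord F θ.ν θ.τ9.M (gOfRecord₁₃ F N θ.toStage13Params p) p.K k s.init,
      Measurable fun U₀ : GaugeField (F.P p.K) k (SU N) =>
        tkBranchOfRecord F N (FluctV N) θ.ν θ.τ9.M _ p.K (WtOfRecord₁₃H F N (rePinH θ) p s) s.init S k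
          (fun ω => sect2Operand F N (FluctV N) p.K (settingOfRecord₁₃ F N θ.toStage13Params p) (θ.rzAt p s.init) s.init t₀ E₀
            (UbgOfRecord₁₃CoP F N θ.toStage13Params p k s.init) (S, fun j => (ω j).2) (fun j => (ω j).1))
          (baseCfg (V := FluctV N) k U₀))
    (hCB : ∀ (t₀ : Sect2.TermValues (F.P p.K) (MatA N) (FluctV N) θ.τ9.M) (E₀ : ℝ),
      ∀ S ∈ admSOfRecord F θ.ν θ.τ9.M (gOfRecord₁₃ F N θ.toStage13Params p) p.K k s.init, ∀ U₀ : GaugeField (F.P p.K) k (SU N),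
      |tkBranchOfRecord F N (FluctV N) θ.ν θ.τ9.M _ p.K (WtOfRecord₁₃H F N (rePinH θ) p s) s.init S k
          (fun ω => sect2Operand F N (FluctV N) p.K (settingOfRecord₁₃ F N θ.toStage13Params p) (θ.rzAt p s.init) s.init t₀ E₀
            (UbgOfRecord₁₃CoP F N θ.toStage13Params p k s.init) (S, fun j => (ω j).2) (fun j => (ω j).1))
          (baseCfg (V := FluctV N) k U₀)| ≤ C) :
    ∃ (t₀ : Sect2.TermValues (F.P p.K) (MatA N) (FluctV N) θ.τ9.M) (E' : ℝ),
      Sect2.LawsRT (sect2TowerOfRecord F N (FluctV N) p.K (settingOfRecord₁₃ F N θ.toStage13Params p) (θ.rzAt p s) s t₀)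
          (settingOfRecord₁₃ F N θ.toStage13Params p).lf (k + 1) ∧
        (slotsOfRecord F N θ.ν θ.τ9 (EOfRecord₁₃ F N θ.toStage13Params) (wOfRecord₉ F N θ.toStage9Params) θ.ppSel p
            (gOfRecord₁₃ F N θ.toStage13Params p) (k + 1) s = 0 ∨
          ∀ᵐ V' ∂fieldMeasure (F.P p.K) (k + 1) (SU N),
            chiSeqOfRecord F N θ.ν θ.τ9.M (gOfRecord₁₃ F N θ.toStage13Params p) p.K (k + 1) s V' ≠ 0 →
              slotsOfRecord F N θ.ν θ.τ9 (EOfRecord₁₃ F N θ.toStage13Params) (wOfRecord₉ F N θ.toStage9Params) θ.ppSel p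
                  (gOfRecord₁₃ F N θ.toStage13Params p) (k + 1) s V' =
                sect2Slot F N (FluctV N) p.K (settingOfRecord₁₃ F N θ.toStage13Params p) (θ.rzAt p s) (WtOfRecord₁₃H F N (rePinH θ) p s) s t₀ E'
                  (UbgOfRecord₁₃CoP F N θ.toStage13Params p (k + 1) s) V') :=
  exists_lawsRT_slotClause_succ_CoPH_of_Omega_empty_of_sLaw₁₃CoPH_of_oldBranch_of_liveSel (rePinH θ) p (provisos₁₃CoPH_rePinH h) hsel hθ hκ hE₀ hB₀ hk hM hS s hΩ
    (fun _ _ _ _ _ => rfl) (prefix_agree_rePinH θ p s hΩ) hA (zhAt_rePinH_ζ0_univ_pairCfgAt θ p hk s hΩ) (fun _ _ => rfl) hmB hCB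

end RePinned

/-! ## §3. At the re-pinned door of node00-def-K0a's cured witness family — every no-expansion history -/

section Door

variable (θ₀ : Stage13Params F N) (p : B12.RunParams)

/-- **★★ THEOREM 1's INDUCTIVE STEP ON EVERY NO-EXPANSION BRANCH AFTER ANY HISTORY, LAWS INCLUDED, AT THE RE-PINNED DOOR `rePinH (Stage13HParams.ofHistoryBlind (Stage13RParams.ofCured θ₀))`
OF K0a's CURED WITNESS FAMILY, READ THROUGH 𝐑**: from `θ₀.Provisos₁₃Core`, node00-def-T's live-selector clause and admissibility of `θ₀`, `0 ≤ κ, E₀, B₀`, `k < K`, `1 ≤ M`, `SLaw₁₃CoPH`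
at the re-pinned door at level `k`, and ONLY `hA`, `hmB`, `hCB` — for EVERY `s′` of length `k+1` with `Ω_{k+1}(s′) = ∅`: THERE ARE `t₀`, `E′` with `LawsRT … (k+1)` AND the post-𝐑 §2
dichotomy of `ρ_{k+1}`'s slot at `s′` in the re-pinned door's weights (§2 at the door: def-T's core provisos there are K0a's `Provisos₁₃Core.ofCured` + `Provisos₁₃CoPR.ofHistoryBlind`;
admissibility reads the Stage-13 part, `Iff.rfl`). [cite: Balaban1988Convergent, Thm 1 p.262, §2 p.262, Theorem p.245, (3.24)–(3.25) p.270, (2.17)–(2.18) p.257, (3.16)–(3.20) pp.268–269, (1.11) p.248, p.279; Balaban1989LargeFieldI, (0.3)–(0.4) p.176, p.177 (i)–(ii)] -/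
theorem exists_lawsRT_slotClause_succ_rePinH_door_ofCured_of_Omega_empty_of_liveSel (h : θ₀.Provisos₁₃Core F N)
    (hsel : θ₀.ppSel = ppSelLiveOfRecord F N θ₀.ν θ₀.τ9 (EOfRecord₁₃ F N θ₀) (wOfRecord₉ F N θ₀.toStage9Params))
    (hθ : θ₀.Admissible F N) (hκ : 0 ≤ θ₀.s2.lf.κ) (hE₀ : 0 ≤ θ₀.s2.lf.E₀) (hB₀ : 0 ≤ θ₀.s2.lf.B₀) {k : ℕ} (hk : k < p.K) (hM : 1 ≤ θ₀.τ9.M)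
    (hS : SLaw₁₃CoPH F N (rePinH (Stage13HParams.ofHistoryBlind F N (Stage13RParams.ofCured F N θ₀))) p k)
    (s : SeqOfRecord F θ₀.ν θ₀.τ9.M (gOfRecord₁₃ F N θ₀ p) p.K (k + 1)) (hΩ : s.Ω (k + 1) = ∅)
    (hA : ∀ (t₀ : Sect2.TermValues (F.P p.K) (MatA N) (FluctV N) θ₀.τ9.M) (E₀ : ℝ) (S : ℕ → Set (Site (F.P p.K) 0))
      (a a' : Tk.MSFluct (F.P p.K) (FluctV N)) (Uf : GaugeField (F.P p.K) 0 (SU N)), (∀ i, i ≤ k → a i = a' i) →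
      (sect2ActionDataOfRecord F N (FluctV N) p.K (settingOfRecord₁₃ F N θ₀ p) (θ₀.Rz p.K) s.init t₀ (S, a) E₀).action23 k Uf =
        (sect2ActionDataOfRecord F N (FluctV N) p.K (settingOfRecord₁₃ F N θ₀ p) (θ₀.Rz p.K) s.init t₀ (S, a') E₀).action23 k Uf)
    {C : ℝ}
    (hmB : ∀ (t₀ : Sect2.TermValues (F.P p.K) (MatA N) (FluctV N) θ₀.τ9.M) (E₀ : ℝ),
      ∀ S ∈ admSOfRecord F θ₀.ν θ₀.τ9.M (gOfRecord₁₃ F N θ₀ p) p.K k s.init,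
      Measurable fun U₀ : GaugeField (F.P p.K) k (SU N) =>
        tkBranchOfRecord F N (FluctV N) θ₀.ν θ₀.τ9.M _ p.K
          (WtOfRecord₁₃H F N (rePinH (Stage13HParams.ofHistoryBlind F N (Stage13RParams.ofCured F N θ₀))) p s) s.init S k
          (fun ω => sect2Operand F N (FluctV N) p.K (settingOfRecord₁₃ F N θ₀ p) (θ₀.Rz p.K) s.init t₀ E₀
            (UbgOfRecord₁₃CoP F N θ₀ p k s.init) (S, fun j => (ω j).2) (fun j => (ω j).1))
          (baseCfg (V := FluctV N) k U₀))
    (hCB : ∀ (t₀ : Sect2.TermValues (F.P p.K) (MatA N) (FluctV N) θ₀.τ9.M) (E₀ : ℝ),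
      ∀ S ∈ admSOfRecord F θ₀.ν θ₀.τ9.M (gOfRecord₁₃ F N θ₀ p) p.K k s.init, ∀ U₀ : GaugeField (F.P p.K) k (SU N),
      |tkBranchOfRecord F N (FluctV N) θ₀.ν θ₀.τ9.M _ p.K
          (WtOfRecord₁₃H F N (rePinH (Stage13HParams.ofHistoryBlind F N (Stage13RParams.ofCured F N θ₀))) p s) s.init S k
          (fun ω => sect2Operand F N (FluctV N) p.K (settingOfRecord₁₃ F N θ₀ p) (θ₀.Rz p.K) s.init t₀ E₀
            (UbgOfRecord₁₃CoP F N θ₀ p k s.init) (S, fun j => (ω j).2) (fun j => (ω j).1))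
          (baseCfg (V := FluctV N) k U₀)| ≤ C) :
    ∃ (t₀ : Sect2.TermValues (F.P p.K) (MatA N) (FluctV N) θ₀.τ9.M) (E' : ℝ),
      Sect2.LawsRT (sect2TowerOfRecord F N (FluctV N) p.K (settingOfRecord₁₃ F N θ₀ p) (θ₀.Rz p.K) s t₀) (settingOfRecord₁₃ F N θ₀ p).lf (k + 1) ∧
        (slotsOfRecord F N θ₀.ν θ₀.τ9 (EOfRecord₁₃ F N θ₀) (wOfRecord₉ F N θ₀.toStage9Params) θ₀.ppSel p (gOfRecord₁₃ F N θ₀ p) (k + 1) s = 0 ∨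
          ∀ᵐ V' ∂fieldMeasure (F.P p.K) (k + 1) (SU N),
            chiSeqOfRecord F N θ₀.ν θ₀.τ9.M (gOfRecord₁₃ F N θ₀ p) p.K (k + 1) s V' ≠ 0 →
              slotsOfRecord F N θ₀.ν θ₀.τ9 (EOfRecord₁₃ F N θ₀) (wOfRecord₉ F N θ₀.toStage9Params) θ₀.ppSel p (gOfRecord₁₃ F N θ₀ p) (k + 1) s V' =
                sect2Slot F N (FluctV N) p.K (settingOfRecord₁₃ F N θ₀ p) (θ₀.Rz p.K)
                  (WtOfRecord₁₃H F N (rePinH (Stage13HParams.ofHistoryBlind F N (Stage13RParams.ofCured F N θ₀))) p s) s t₀ E'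
                  (UbgOfRecord₁₃CoP F N θ₀ p (k + 1) s) V') :=
  exists_lawsRT_slotClause_succ_rePinH_of_Omega_empty_of_sLaw₁₃CoPH_of_oldBranch_of_liveSel (Stage13HParams.ofHistoryBlind F N (Stage13RParams.ofCured F N θ₀)) p
    h.ofCured.ofHistoryBlind hsel hθ hκ hE₀ hB₀ hk hM hS s hΩ hA hmB hCB

end Door

section DoorRecord

variable (F N)
variable (p : B12.RunParams)

/-- **★★ … AT THE RE-PINNED DOOR OF THE CURED WITNESS OF RECORD** `rePinH (Stage13HParams.ofHistoryBlind (Stage13RParams.ofCured (theta13LiveOfRecord F N)))`, EVERY no-expansion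
history: from `Provisos₁₃Core` AT THE WITNESS, `k < K`, `SLaw` at the re-pinned door at level `k`, `hA`, `hmB`, `hCB` ONLY — the selector clause is K0a's
`liveRepin₁₃_liveSel`, admissibility K0a's `admissible_theta13LiveOfRecord`, `M = 1`, `κ = 2·10⁴`, `E₀ = B₀ = 1` by the family's numerals: `∃ t₀ E′`, `LawsRT … (k+1)` ∧ the
post-𝐑 §2 dichotomy of `ρ_{k+1}`'s slot at `s′`. [cite: Balaban1988Convergent, Thm 1 p.262, §2 p.262, Theorem p.245, (3.24)–(3.25) p.270, (1.11) p.248, (3.16)–(3.22) pp.268–269, p.279; Balaban1989LargeFieldI, (0.3)–(0.4) p.176, p.177 (i)–(ii)] -/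
theorem exists_lawsRT_slotClause_succ_rePinH_door_theta13LiveOfRecord_of_Omega_empty (h : (theta13LiveOfRecord F N).Provisos₁₃Core F N) {k : ℕ} (hk : k < p.K)
    (hS : SLaw₁₃CoPH F N (rePinH (Stage13HParams.ofHistoryBlind F N (Stage13RParams.ofCured F N (theta13LiveOfRecord F N)))) p k)
    (s : SeqOfRecord F (theta13LiveOfRecord F N).ν (theta13LiveOfRecord F N).τ9.M (gOfRecord₁₃ F N (theta13LiveOfRecord F N) p) p.K (k + 1))
    (hΩ : s.Ω (k + 1) = ∅)
    (hA : ∀ (t₀ : Sect2.TermValues (F.P p.K) (MatA N) (FluctV N) (theta13LiveOfRecord F N).τ9.M) (E₀ : ℝ) (S : ℕ → Set (Site (F.P p.K) 0))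
      (a a' : Tk.MSFluct (F.P p.K) (FluctV N)) (Uf : GaugeField (F.P p.K) 0 (SU N)), (∀ i, i ≤ k → a i = a' i) →
      (sect2ActionDataOfRecord F N (FluctV N) p.K (settingOfRecord₁₃ F N (theta13LiveOfRecord F N) p) ((theta13LiveOfRecord F N).Rz p.K) s.init t₀ (S, a) E₀).action23 k Uf =
        (sect2ActionDataOfRecord F N (FluctV N) p.K (settingOfRecord₁₃ F N (theta13LiveOfRecord F N) p) ((theta13LiveOfRecord F N).Rz p.K) s.init t₀ (S, a') E₀).action23 k Uf)
    {C : ℝ}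
    (hmB : ∀ (t₀ : Sect2.TermValues (F.P p.K) (MatA N) (FluctV N) (theta13LiveOfRecord F N).τ9.M) (E₀ : ℝ),
      ∀ S ∈ admSOfRecord F (theta13LiveOfRecord F N).ν (theta13LiveOfRecord F N).τ9.M (gOfRecord₁₃ F N (theta13LiveOfRecord F N) p) p.K k s.init,
      Measurable fun U₀ : GaugeField (F.P p.K) k (SU N) =>
        tkBranchOfRecord F N (FluctV N) (theta13LiveOfRecord F N).ν (theta13LiveOfRecord F N).τ9.M _ p.K
          (WtOfRecord₁₃H F N (rePinH (Stage13HParams.ofHistoryBlind F N (Stage13RParams.ofCured F N (theta13LiveOfRecord F N)))) p s) s.init S k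
          (fun ω => sect2Operand F N (FluctV N) p.K (settingOfRecord₁₃ F N (theta13LiveOfRecord F N) p) ((theta13LiveOfRecord F N).Rz p.K) s.init t₀ E₀
            (UbgOfRecord₁₃CoP F N (theta13LiveOfRecord F N) p k s.init) (S, fun j => (ω j).2) (fun j => (ω j).1))
          (baseCfg (V := FluctV N) k U₀))
    (hCB : ∀ (t₀ : Sect2.TermValues (F.P p.K) (MatA N) (FluctV N) (theta13LiveOfRecord F N).τ9.M) (E₀ : ℝ),
      ∀ S ∈ admSOfRecord F (theta13LiveOfRecord F N).ν (theta13LiveOfRecord F N).τ9.M (gOfRecord₁₃ F N (theta13LiveOfRecord F N) p) p.K k s.init,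
      ∀ U₀ : GaugeField (F.P p.K) k (SU N),
      |tkBranchOfRecord F N (FluctV N) (theta13LiveOfRecord F N).ν (theta13LiveOfRecord F N).τ9.M _ p.K
          (WtOfRecord₁₃H F N (rePinH (Stage13HParams.ofHistoryBlind F N (Stage13RParams.ofCured F N (theta13LiveOfRecord F N)))) p s) s.init S k
          (fun ω => sect2Operand F N (FluctV N) p.K (settingOfRecord₁₃ F N (theta13LiveOfRecord F N) p) ((theta13LiveOfRecord F N).Rz p.K) s.init t₀ E₀
            (UbgOfRecord₁₃CoP F N (theta13LiveOfRecord F N) p k s.init) (S, fun j => (ω j).2) (fun j => (ω j).1))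
          (baseCfg (V := FluctV N) k U₀)| ≤ C) :
    ∃ (t₀ : Sect2.TermValues (F.P p.K) (MatA N) (FluctV N) (theta13LiveOfRecord F N).τ9.M) (E' : ℝ),
      Sect2.LawsRT (sect2TowerOfRecord F N (FluctV N) p.K (settingOfRecord₁₃ F N (theta13LiveOfRecord F N) p) ((theta13LiveOfRecord F N).Rz p.K) s t₀)
          (settingOfRecord₁₃ F N (theta13LiveOfRecord F N) p).lf (k + 1) ∧
        (slotsOfRecord F N (theta13LiveOfRecord F N).ν (theta13LiveOfRecord F N).τ9 (EOfRecord₁₃ F N (theta13LiveOfRecord F N))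
            (wOfRecord₉ F N (theta13LiveOfRecord F N).toStage9Params) (theta13LiveOfRecord F N).ppSel p (gOfRecord₁₃ F N (theta13LiveOfRecord F N) p) (k + 1) s = 0 ∨
          ∀ᵐ V' ∂fieldMeasure (F.P p.K) (k + 1) (SU N),
            chiSeqOfRecord F N (theta13LiveOfRecord F N).ν (theta13LiveOfRecord F N).τ9.M (gOfRecord₁₃ F N (theta13LiveOfRecord F N) p) p.K (k + 1) s V' ≠ 0 →
              slotsOfRecord F N (theta13LiveOfRecord F N).ν (theta13LiveOfRecord F N).τ9 (EOfRecord₁₃ F N (theta13LiveOfRecord F N))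
                  (wOfRecord₉ F N (theta13LiveOfRecord F N).toStage9Params) (theta13LiveOfRecord F N).ppSel p (gOfRecord₁₃ F N (theta13LiveOfRecord F N) p) (k + 1) s V' =
                sect2Slot F N (FluctV N) p.K (settingOfRecord₁₃ F N (theta13LiveOfRecord F N) p) ((theta13LiveOfRecord F N).Rz p.K)
                  (WtOfRecord₁₃H F N (rePinH (Stage13HParams.ofHistoryBlind F N (Stage13RParams.ofCured F N (theta13LiveOfRecord F N)))) p s) s t₀ E'
                  (UbgOfRecord₁₃CoP F N (theta13LiveOfRecord F N) p (k + 1) s) V') :=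
  exists_lawsRT_slotClause_succ_rePinH_door_ofCured_of_Omega_empty_of_liveSel (theta13LiveOfRecord F N) p h
    (B16RLeafRecord13AtLive.liveRepin₁₃_liveSel F N (theta13OfFamily F N eps0OfRecord₁₃ _ _ _)) (admissible_theta13LiveOfRecord F N)
    (B16RLeafRecord13AtLive.kappa_nonneg_theta13LiveOfFamily F N eps0OfRecord₁₃ (zeta316OfRecord F N (numerics7OfFamily eps0OfRecord₁₃) 1 1) (RzOfRecord F N) (ZtOfRecord F N))
    (B16RLeafRecord13AtLive.E0_nonneg_theta13LiveOfFamily F N eps0OfRecord₁₃ (zeta316OfRecord F N (numerics7OfFamily eps0OfRecord₁₃) 1 1) (RzOfRecord F N) (ZtOfRecord F N))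
    (B16RLeafRecord13AtLive.B0_nonneg_theta13LiveOfFamily F N eps0OfRecord₁₃ (zeta316OfRecord F N (numerics7OfFamily eps0OfRecord₁₃) 1 1) (RzOfRecord F N) (ZtOfRecord F N))
    hk (le_of_eq rfl) hS s hΩ hA hmB hCB

end DoorRecord

end Summit.QuantumFields.YangMills.Theorems.BalabanUVNodesN11NoExpansionGeneralStepRePinnedLawsCoPH

end
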